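import Summits.MatrixMultiplication.MatrixMultiplication.Theses.ObstructionDescent

/-!
# `E` in normal form: homogeneous, type-free occurrence-blindness in polynomial degree
(decomp-mm · lens 3 · gen 18, fifth kernel)

Route `route-MatrixMultiplication-ObstructionDescent` (`ω(ℂ) = 2`), item `E = NoPolyDegreeObstruction` (30889).  The vanishing
ideal of a `GL_m³`-orbit is HOMOGENEOUS (the orbit is stable under `t ↦ c·t`, `c ≠ 0`: scale `A`), so every homogeneous
component of a polynomial vanishing on `GL_m³·x` vanishes there (`orbitVanishing_homogeneousComponent`, the one-variable
polynomial `c ↦ f(c·y)` has infinitely many roots).  Consequences: `E` is equivalent to its restriction to HOMOGENEOUS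
equations (`noPolyDegreeObstruction_iff_homogeneous`), and hence to the type-free slice form of
`ObstructionDescentPolyDegreeSlices` — for every `c`, at the cells of `E`, for every `d ≤ m^c` and every set `W ⊆ S^d`,
`W ∩ I(GL_m³·⟨m⟩) ⊆ W ∩ I(GL_m³·pad_m⟨n,n,n⟩)` (`noPolyDegreeObstruction_iff_slices`; the forward direction is the
landed `ObstructionDescentPolyDegreeSlices.occurrenceSlice_of_noPolyDegreeObstruction`, re-derived here in three lines so
that this module imports only the route file).  So the degree axis IS «occurrence-
blindness for all (not necessarily B³-semi-invariant) degree-`d` forms, `d` polynomial in `m`»; the information axis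
`P_O` asks the same for weight spaces only, in all degrees.  No proposition is defined; sorry-free; standard axioms.
[cite: BurgisserIkenmeyer2011, §3.1 (arXiv:1011.1350 p. 6); LandsbergGCT2017, §8.1 (ideals of `G`-varieties are graded)]
-/

set_option linter.dupNamespace false
set_option autoImplicit false

noncomputable section

open scoped BigOperators

namespace Summit.MatrixMultiplication.MatrixMultiplication.Theorems.ObstructionDescentHomogeneousSlices

open Literature.Computability.AlgebraicComplexity (actTensor unitTensor matMulTensor)
open Summit.MatrixMultiplication.MatrixMultiplication.Theses.ObstructionDescent (NoPolyDegreeObstruction)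

/-! ## §1 Scaling -/

/-- Scaling the first matrix scales the tensor: `(cA, B, C)·x = c·((A,B,C)·x)`. [bookkeeping] -/
theorem actTensor_smul_left {m : ℕ} (c : ℂ) (A B C : Matrix (Fin m) (Fin m) ℂ) (x : Fin m → Fin m → Fin m → ℂ) :
    actTensor (c • A) B C x = c • actTensor A B C x := by
  funext i j l
  simp only [Literature.Computability.AlgebraicComplexity.actTensor_apply, Matrix.smul_apply, Pi.smul_apply,
    smul_eq_mul, Finset.mul_sum]
  exact Finset.sum_congr rfl fun _ _ => Finset.sum_congr rfl fun _ _ => Finset.sum_congr rfl fun _ _ => by ring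

/-- A homogeneous form of degree `d` scales by `c^d`: `f(c·y) = c^d·f(y)` (`aeval` form, any index type). [folklore] -/
theorem aeval_smul_of_isHomogeneous {ι : Type} {f : MvPolynomial ι ℂ} {d : ℕ} (hf : f.IsHomogeneous d) (c : ℂ)
    (y : ι → ℂ) : MvPolynomial.aeval (c • y) f = c ^ d * MvPolynomial.aeval y f := by
  simp only [MvPolynomial.aeval_def, MvPolynomial.eval₂_eq, Algebra.algebraMap_self_apply, Finset.mul_sum]
  refine Finset.sum_congr rfl fun s hs => ?_
  have hd : s.degree = d := by
    by_contra h
    exact (MvPolynomial.mem_support_iff.mp hs) (hf.coeff_eq_zero h)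
  subst hd
  simp only [Pi.smul_apply, smul_eq_mul, mul_pow, Finset.prod_mul_distrib, Finset.prod_pow_eq_pow_sum,
    Finsupp.degree_apply]
  ring

/-! ## §2 The vanishing ideal of a `GL_m³`-orbit is homogeneous -/

/-- **Orbit ideals are homogeneous**: if `f` vanishes on `GL_m³·x` then so does each homogeneous component of `f`
(the polynomial `c ↦ f((cA,B,C)·x) = Σ_i c^i f_i((A,B,C)·x)` vanishes at every `c ≠ 0`, an infinite set).
[cite: LandsbergGCT2017, §8.1; BurgisserIkenmeyer2011, §3.1] -/
theorem orbitVanishing_homogeneousComponent {m : ℕ} (x : Fin m → Fin m → Fin m → ℂ)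
    {f : MvPolynomial (Fin m × Fin m × Fin m) ℂ}
    (hf : ∀ A B C : Matrix (Fin m) (Fin m) ℂ, A.det ≠ 0 → B.det ≠ 0 → C.det ≠ 0 →
      MvPolynomial.aeval (fun p : Fin m × Fin m × Fin m => actTensor A B C x p.1 p.2.1 p.2.2) f = 0) (i : ℕ) :
    ∀ A B C : Matrix (Fin m) (Fin m) ℂ, A.det ≠ 0 → B.det ≠ 0 → C.det ≠ 0 →
      MvPolynomial.aeval (fun p : Fin m × Fin m × Fin m => actTensor A B C x p.1 p.2.1 p.2.2)
        (MvPolynomial.homogeneousComponent i f) = 0 := by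
  classical
  intro A B C hA hB hC
  set y : Fin m × Fin m × Fin m → ℂ := fun p => actTensor A B C x p.1 p.2.1 p.2.2 with hy
  -- the one-variable polynomial `q(c) = Σ_i f_i(y) c^i`
  set q : Polynomial ℂ := ∑ j ∈ Finset.range (f.totalDegree + 1),
    Polynomial.C (MvPolynomial.aeval y (MvPolynomial.homogeneousComponent j f)) * Polynomial.X ^ j with hq
  have hq_eval : ∀ c : ℂ, q.eval c = MvPolynomial.aeval (c • y) f := fun c => by
    conv_rhs => rw [← MvPolynomial.sum_homogeneousComponent f, map_sum]
    simp only [hq, Polynomial.eval_finsetSum, Polynomial.eval_mul, Polynomial.eval_C, Polynomial.eval_pow,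
      Polynomial.eval_X]
    refine Finset.sum_congr rfl fun j _ => ?_
    rw [aeval_smul_of_isHomogeneous (MvPolynomial.homogeneousComponent_isHomogeneous j f), mul_comm]
  -- every `c ≠ 0` is a root: `c • y` is the point `(cA, B, C)·x` of the orbit
  have hroot : ∀ c : ℂ, c ≠ 0 → q.IsRoot c := fun c hc => by
    rw [Polynomial.IsRoot, hq_eval]
    have hcy : c • y = fun p : Fin m × Fin m × Fin m => actTensor (c • A) B C x p.1 p.2.1 p.2.2 := by
      funext p
      rw [actTensor_smul_left]
      rfl
    rw [hcy]
    refine hf (c • A) B C ?_ hB hC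
    rw [Matrix.det_smul, Fintype.card_fin]
    exact mul_ne_zero (pow_ne_zero _ hc) hA
  have hinf : Set.Infinite {c : ℂ | c ≠ 0} := by
    have : ({c : ℂ | c ≠ 0}) = ({0} : Set ℂ)ᶜ := by ext c; simp
    rw [this]
    exact (Set.finite_singleton (0 : ℂ)).infinite_compl
  have hq0 : q = 0 :=
    Polynomial.eq_zero_of_infinite_isRoot q (hinf.mono fun c hc => hroot c hc)
  have hcoeff : ∀ j, q.coeff j = if j ∈ Finset.range (f.totalDegree + 1) then
      MvPolynomial.aeval y (MvPolynomial.homogeneousComponent j f) else 0 := fun j => by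
    simp only [hq, Polynomial.finsetSum_coeff, Polynomial.coeff_C_mul_X_pow]
    rw [Finset.sum_ite_eq]
  by_cases hi : i ∈ Finset.range (f.totalDegree + 1)
  · have := hcoeff i
    rwa [if_pos hi, hq0, Polynomial.coeff_zero, eq_comm] at this
  · rw [Finset.mem_range, not_lt, Nat.succ_le_iff] at hi
    rw [MvPolynomial.homogeneousComponent_eq_zero i f hi, map_zero]

/-! ## §3 `E` ⟺ `E` on homogeneous equations -/

/-- **`E` is equivalent to its restriction to HOMOGENEOUS equations** of degree `d ≤ m^c` (each homogeneous component of
an equation of degree `≤ m^c` vanishing on `GL_m³·⟨m⟩` is such an equation, §2, and the pad-vanishing set is closed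
under sums). [cite: BurgisserIkenmeyer2011, §3.1] -/
theorem noPolyDegreeObstruction_iff_homogeneous : NoPolyDegreeObstruction ↔
    ∀ c : ℕ, ∀ τ : ℝ, 2 < τ → ∃ n₀ : ℕ, ∀ n m : ℕ, n₀ ≤ n → ∀ h : n * n ≤ m, (n : ℝ) ^ τ ≤ (m : ℝ) →
      ∀ (d : ℕ) (f : MvPolynomial (Fin m × Fin m × Fin m) ℂ), f.IsHomogeneous d → d ≤ m ^ c →
        (∀ A B C : Matrix (Fin m) (Fin m) ℂ, A.det ≠ 0 → B.det ≠ 0 → C.det ≠ 0 →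
          MvPolynomial.aeval (fun p : Fin m × Fin m × Fin m => actTensor A B C (unitTensor ℂ m) p.1 p.2.1 p.2.2) f = 0) →
        ∀ A B C : Matrix (Fin m) (Fin m) ℂ, A.det ≠ 0 → B.det ≠ 0 → C.det ≠ 0 →
          MvPolynomial.aeval (fun p : Fin m × Fin m × Fin m => actTensor A B C
            ((fun a b c : Fin m => ∑ r : (Fin n × Fin n) × (Fin n × Fin n) × (Fin n × Fin n),
              (if Fin.castLE h (finProdFinEquiv r.1) = a ∧ Fin.castLE h (finProdFinEquiv r.2.1) = b ∧
                Fin.castLE h (finProdFinEquiv r.2.2) = c then (1 : ℂ) else 0) * matMulTensor ℂ n n n r.1 r.2.1 r.2.2))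
            p.1 p.2.1 p.2.2) f = 0 := by
  constructor
  · intro hE c τ hτ
    obtain ⟨n₀, hn₀⟩ := hE c τ hτ
    exact ⟨n₀, fun n m hn h hτm d f hf hd hU => hn₀ n m hn h hτm f (hf.totalDegree_le.trans hd) hU⟩
  · intro hH c τ hτ
    obtain ⟨n₀, hn₀⟩ := hH c τ hτ
    refine ⟨n₀, fun n m hn h hτm f hdeg hU A B C hA hB hC => ?_⟩
    classical
    rw [← MvPolynomial.sum_homogeneousComponent f, map_sum]
    refine Finset.sum_eq_zero fun i hi => ?_
    have hi' : i ≤ m ^ c := (Nat.lt_succ_iff.1 (Finset.mem_range.1 hi)).trans hdeg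
    exact hn₀ n m hn h hτm i _ (MvPolynomial.homogeneousComponent_isHomogeneous i f) hi'
      (orbitVanishing_homogeneousComponent (unitTensor ℂ m) hU i) A B C hA hB hC

/-! ## §4 `E` ⟺ the type-free slices -/

/-- **`E` in slice normal form**: `E` holds iff for every `c`, at the cells of `E(c)`, for every degree `d ≤ m^c` and
EVERY set `W` of degree-`d` forms, `W ∩ I(GL_m³·⟨m⟩) ⊆ W ∩ I(GL_m³·pad_m⟨n,n,n⟩)` (→ as in
`ObstructionDescentPolyDegreeSlices.occurrenceSlice_of_noPolyDegreeObstruction`; ← takes `W = {f}` and §3).  The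
information axis `P_O = NoOccurrenceObstruction` is the same containment for the WEIGHT SPACES `W(Λ, d)` only, in ALL
degrees `d`. [cite: BurgisserIkenmeyer2011, §3.1 and Thm. 4.6 (arXiv p. 6)] -/
theorem noPolyDegreeObstruction_iff_slices : NoPolyDegreeObstruction ↔
    ∀ c : ℕ, ∀ τ : ℝ, 2 < τ → ∃ n₀ : ℕ, ∀ n m : ℕ, n₀ ≤ n → ∀ h : n * n ≤ m, (n : ℝ) ^ τ ≤ (m : ℝ) →
      ∀ (d : ℕ) (W : Set (MvPolynomial (Fin m × Fin m × Fin m) ℂ)), W ⊆ {f | f.IsHomogeneous d} → d ≤ m ^ c →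
        (∀ f ∈ W, ∀ A B C : Matrix (Fin m) (Fin m) ℂ, A.det ≠ 0 → B.det ≠ 0 → C.det ≠ 0 →
          MvPolynomial.aeval (fun p : Fin m × Fin m × Fin m => actTensor A B C (unitTensor ℂ m) p.1 p.2.1 p.2.2) f = 0) →
        ∀ f ∈ W, ∀ A B C : Matrix (Fin m) (Fin m) ℂ, A.det ≠ 0 → B.det ≠ 0 → C.det ≠ 0 →
          MvPolynomial.aeval (fun p : Fin m × Fin m × Fin m => actTensor A B C
            ((fun a b c : Fin m => ∑ r : (Fin n × Fin n) × (Fin n × Fin n) × (Fin n × Fin n),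
              (if Fin.castLE h (finProdFinEquiv r.1) = a ∧ Fin.castLE h (finProdFinEquiv r.2.1) = b ∧
                Fin.castLE h (finProdFinEquiv r.2.2) = c then (1 : ℂ) else 0) * matMulTensor ℂ n n n r.1 r.2.1 r.2.2))
            p.1 p.2.1 p.2.2) f = 0 := by
  constructor
  · intro hE c τ hτ
    obtain ⟨n₀, hn₀⟩ := hE c τ hτ
    refine ⟨n₀, fun n m hn h hτm d W hW hd hU f hf => ?_⟩
    have hhom : f.IsHomogeneous d := hW hf
    exact hn₀ n m hn h hτm f (hhom.totalDegree_le.trans hd) (hU f hf)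
  · intro hS
    refine noPolyDegreeObstruction_iff_homogeneous.2 fun c τ hτ => ?_
    obtain ⟨n₀, hn₀⟩ := hS c τ hτ
    refine ⟨n₀, fun n m hn h hτm d f hf hd hU => ?_⟩
    exact hn₀ n m hn h hτm d {f} (fun g hg => by rw [Set.mem_singleton_iff.1 hg]; exact hf) hd
      (fun g hg => by rw [Set.mem_singleton_iff.1 hg]; exact hU) f (Set.mem_singleton f)

end Summit.MatrixMultiplication.MatrixMultiplication.Theorems.ObstructionDescentHomogeneousSlices

end
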